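import Literature.AlgebraicGeometry.ShimuraVarieties.UnitaryShimuraCurveEmbeddedImageClosed
import Literature.AlgebraicGeometry.ShimuraVarieties.UnitaryBallTranslatedSubdiscClosed
import HarnessLib

/-!
# L3.2 «F-IMG» of road (ii): the embedded unitary Shimura curve is Zariski-closed among the complex points of the surface's
# canonical model — over PINNED, `L`-CODED pieces (the CUT's signature)

Topic `AlgebraicGeometry/ShimuraVarieties`, namespace `…ShimuraVarieties.UnitaryCanonicalModel`. THEOREMS ONLY (no definition, no
named fact, no instance, no `sorry`).  Cell `hodgecm-mathlib`, road (ii) «embedded-curve descent», CUT `CUT-R2-5-FIELDS` leaf L3.2;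
books 0.  This file only COMPOSES ★ `RecordSystem.mem_range_emb_of_pt_mem_closure_of_pieces` (part (a): the assembly from a per-piece
closedness clause) with ★ `UnitaryBallUniformisationDatum.exists_isClosed_pt_mem_iff_eq_unif_frameEmbNeg` (part (b): the clause, from
Kudla–Millson special cycles over a subfield code), in the currency fixed by A-plan1 (g9)'s «E-OPACITY» ruling (2026-08-29T05:49:44Z):
PINNED pieces `(g, X, ι, B_q)` of `(M_K)_τ` read through SubfieldCodes `e_q : L ≃+* B_q.E` over `τ` with `B_q.H = H^{e_q}` — the
head (L3.7) feeds them from ★ `HComp.RecordSystem.exists_pieces_fieldRange` and its read-outs.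

RESULT **`RecordSystem.mem_range_emb_of_pt_mem_closure`** = the hypothesis `himg` of L3.4 ★ `…exists_homeomorph_complexPoints_of_range_eq_closure_embPoints`:
every complex point of `(M_K)_τ` on the Zariski closure `C(K⋆, K)` of the embedded curve is an embedded point.
[Milne2005ShimuraVarieties] Thm. 5.16 / Lemma 5.13; [BergeronMillsonMoeglin2016Balls] Part 2 §§3.1–3.3; [KudlaMillson1990] Lemma 1.1.

## References
* [Milne2005ShimuraVarieties] J. S. Milne, *Introduction to Shimura varieties* (2005/2017): Lemma 5.13 p. 57, Thm. 5.16 p. 59, §13.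
* [BergeronMillsonMoeglin2016Balls] N. Bergeron, J. Millson, C. Moeglin, Acta Math. 216 (2016), Part 2 §§3.1–3.3.
* [KudlaMillson1990] S. Kudla, J. Millson, Publ. Math. IHÉS 71 (1990), Lemma 1.1, p. 128 and p. 133.
-/

set_option autoImplicit false

noncomputable section

open Function MulAction Topology NumberField IsDedekindDomain CategoryTheory CategoryTheory.Limits Matrix AlgebraicGeometry Set
open scoped Matrix ComplexOrder
open Literature.AlgebraicGeometry.Motives
open Literature.NumberTheory.Automorphic Literature.NumberTheory.Automorphic.UnitaryGroup
open Literature.NumberTheory.Automorphic.Liu2021.AppendixC (C5.OpenCompactSubgroup C5.SmallLevel)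
open Literature.Geometry.ComplexHyperbolic Literature.Geometry.ComplexHyperbolic.BallModel
open Literature.NumberTheory.Automorphic.ShimuraDissection

namespace Literature.AlgebraicGeometry.ShimuraVarieties.UnitaryCanonicalModel

variable {L : Type} [Field L] [NumberField L] [IsCMField L] {Jstar : Matrix (Fin 2) (Fin 2) L} {τ : L →+* ℂ}
  {K₀ : C5.OpenCompactSubgroup ↥(finAdelic (↥(maximalRealSubfield L)) L (IsCMField.complexConj L) 2 Jstar)}
  {H : Matrix (Fin 3) (Fin 3) L} {T : GL (Fin 3) ℂ} {hT : formCongr (starRingEnd ℂ) T (H.map τ) = BallModel.J}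
  {K₀' : C5.OpenCompactSubgroup ↥(finAdelic (↥(maximalRealSubfield L)) L (IsCMField.complexConj L) 3 H)}
  (R : RecordSystem L H τ T hT K₀')
  (Jperp : Matrix (Fin 1) (Fin 1) L) (B : GL (Fin 3) L) {a : L} (ha : a ≠ 0)
  (hB : formCongr ((IsCMField.complexConj L : L ≃ₐ[↥(maximalRealSubfield L)] L) : L →+* L) B (a • H) = finSum 2 1 Jstar Jperp)
  (hτa : 0 < (τ a).re) (hτa' : (τ a).im = 0)

set_option maxHeartbeats 400000 in -- instance-heavy adelic / Shimura-set statement: `whnf`/`isDefEq` time out at the default (as ★ F-R23 / ★ part (a))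
/-- **L3.2 F-IMG — the embedded unitary Shimura curve is Zariski-closed among complex points (PINNED, `L`-coded pieces).**  For an
anisotropic `H`, a frame `ᵗ(cB)·(a·H)·B = J⋆ ⊕ J⊥` with `τ a` a positive real and `Re τ(J⊥₀₀) > 0`, a small curve level `K⋆`, a surface
level `K` with `φGS(K⋆) ≤ K`, and the pieces `(g, X, ι, B_q)` of `(M_K)_τ` (representatives, colimit cofan of compact ball quotients,
uniformisation clause) read through subfield codes `e_q : L ≃+* B_q.E` over `τ` with `B_q.H = H^{e_q}`: every complex point `Q` of
`(M_K)_τ` whose underlying point lies in the Zariski closure of the embedded curve IS an embedded point.  (Part (a) ★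
`mem_range_emb_of_pt_mem_closure_of_pieces` fed with part (b) ★ `exists_isClosed_pt_mem_iff_eq_unif_frameEmbNeg`.)
[cite: Milne2005ShimuraVarieties, Thm. 5.16 p. 59, Lemma 5.13 p. 57] [cite: BergeronMillsonMoeglin2016Balls, Part 2 §§3.1–3.3]
[cite: KudlaMillson1990, Lemma 1.1, p. 128 and p. 133] -/
theorem RecordSystem.mem_range_emb_of_pt_mem_closure
    (hanis : ∀ v : Fin 3 → L, hermForm (cmConjRingHom L) H v v = 0 → v = 0) (hpos : 0 < (τ (Jperp 0 0)).re)
    (Kstar : C5.SmallLevel K₀) (K : C5.SmallLevel K₀') (hK : Kstar.1.1.map (φGS L Jstar Jperp H B ha hB) ≤ K.1.1)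
    (g : orbitRel.Quotient ↥(rational (↥(maximalRealSubfield L)) L (IsCMField.complexConj L) 3 H)
        (CosetSpace (rationalToFinAdelic (↥(maximalRealSubfield L)) L (IsCMField.complexConj L) 3 H) K.1.1) →
      ↥(finAdelic (↥(maximalRealSubfield L)) L (IsCMField.complexConj L) 3 H))
    (hg : ∀ q, Quotient.mk'' (CosetSpace.pt (rationalToFinAdelic (↥(maximalRealSubfield L)) L (IsCMField.complexConj L) 3 H)
      K.1.1 (g q)) = q)
    (X : orbitRel.Quotient ↥(rational (↥(maximalRealSubfield L)) L (IsCMField.complexConj L) 3 H)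
        (CosetSpace (rationalToFinAdelic (↥(maximalRealSubfield L)) L (IsCMField.complexConj L) 3 H) K.1.1) → SchemeOver ℂ)
    (ι : letI : Algebra L ℂ := τ.toAlgebra; ∀ q, X q ⟶ (Motives.baseChangeHom τ).obj (R.M.obj K))
    (hcol : letI : Algebra L ℂ := τ.toAlgebra; IsColimit (Cofan.mk ((Motives.baseChangeHom τ).obj (R.M.obj K)) ι))
    (Bq : ∀ q, UnitaryBallUniformisationDatum 2 (X q))
    (e : ∀ q, L ≃+* ↥(Bq q).E) (he : ∀ q (x : L), ((e q x : ↥(Bq q).E) : ℂ) = τ x) (hHq : ∀ q, (Bq q).H = H.map (e q).toRingHom)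
    (hunif : letI : Algebra L ℂ := τ.toAlgebra
      ∀ q (x : Ball), AlgPoints.map (L := ℂ) (ι q) ((Bq q).unif ((T : Matrix (Fin 3) (Fin 3) ℂ) *ᵥ BallModel.lift x)) =
        AlgPoints.baseChangeEquiv τ (R.M.obj K) ((R.pts K).symm (ShimuraSet.mk L H τ T hT K.1.1 x (g q))))
    (Q : letI : Algebra L ℂ := τ.toAlgebra; ComplexPoints ((Motives.baseChangeHom τ).obj (R.M.obj K)))
    (hQ : letI : Algebra L ℂ := τ.toAlgebra
      Q.pt ∈ closure (AlgPoints.pt '' Set.range fun P : ShimuraSetGS L Jstar τ Kstar.1.1 =>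
        AlgPoints.baseChangeEquiv τ (R.M.obj K) ((R.pts K).symm
          (ShimuraSetGS.embPoints L H τ T hT Jstar Jperp B ha hB hτa hτa' Kstar.1.1 K.1.1 hK P)))) :
    letI : Algebra L ℂ := τ.toAlgebra
    Q ∈ Set.range fun P : ShimuraSetGS L Jstar τ Kstar.1.1 =>
      AlgPoints.baseChangeEquiv τ (R.M.obj K) ((R.pts K).symm
        (ShimuraSetGS.embPoints L H τ T hT Jstar Jperp B ha hB hτa hτa' Kstar.1.1 K.1.1 hK P)) :=
  R.mem_range_emb_of_pt_mem_closure_of_pieces Jperp B ha hB hτa hτa' hanis Kstar K hK g hg X ι hcol Bq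
    (fun q => (Bq q).Hℂ_eq_map_of_code τ (e q) (he q) (hHq q))
    hunif (fun q γ => (Bq q).exists_isClosed_pt_mem_iff_eq_unif_frameEmbNeg τ (e q) (he q) (hHq q) Jperp B ha hB hτa hτa' hpos γ)
    Q hQ

end Literature.AlgebraicGeometry.ShimuraVarieties.UnitaryCanonicalModel

end
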